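import Literature.MathematicalPhysics.QuantumFieldTheory.Balaban1983to89.B8Lemma1NonAbelian
import Literature.MathematicalPhysics.QuantumFieldTheory.Balaban1983to89.B7Prop1Local
import HarnessLib

/-!
# `UnitScaleTiltAxialGaugeCombWalk` — WALKING THE COMB OF THE COMPLETE AXIAL GAUGE ON `ℤ^d`: the rung recursion, a segment of rungs read at two
# translates, and the reduction of a bond's translation discrepancy to the reset point (file 1∕2 of R1′; file 2∕2 ✓`UnitScaleTiltAxialGaugeBondModulus`
# assembles the translation modulus of an axial-gauge bond variable from it) (route `UnitScaleTilt`, crux K1′ `MinimiserStabilityRegPr`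
# stmt-QuantumFields-19200, (L3′b)-GRAD row (★) «η-scale ½-Hölder modulus of the axial-gauge representative», piece R1′ = the ladder comparison in
# POINTWISE form; ★★OWNER RULING №35-B, ★p1 g25 CHAIR WORD №4 «R1 + the torus transfer → px19»)

Cell `ym3-torus` (YM ladder rung R3 = continuum SU(2) Yang–Mills on T³ — a RUNG, NOT the Clay problem: not d = 4, not infinite volume, not a mass gap);
width seat `ym3-torus-px19` (gen 12); helper `--supports stmt-QuantumFields-19200`.  THEOREMS ONLY (0 `def`, 0 `sorry`, default heartbeats), on the
`ℤ^d` carrier of lit ✓`B7Prop1Explicit` ∕ ✓`B8Lemma1NonAbelian` (`hol`, `plaqWord`, `gaugeAct`, `axialFn`, `lowPart`, ✓`axial_treeBond_eq_one`),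
§2 for any group, §3–§5 for any `[GaugeGroup G]` (`dist1`).

THE MECHANISM.  `W := V^{v₀}`, `v₀ = axialFn V 0` (complete axial gauge based at `0`, comb order `d−1, …, 0`).  Tree bonds are trivial:
`W(z, κ) = 1` whenever `z` vanishes below `κ` (✓`axial_treeBond_eq_one`).  Hence the RUNG RECURSION (§2 `axial_bond_step`): for `κ < μ` and `z`
vanishing below `κ`, `W(z + e_κ, μ) = W(∂p_{κμ}(z)) · W(z, μ)` — one rung of the non-abelian Stokes ladder with trivial rails.  Comparing the
recursion at `z` and at `z + t` for a translation `t` vanishing below `κ` (§3 `dist1_rung`, `seg_rungs`): the discrepancy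
`D(z, t) := dist1 (W(z + t, μ)·W(z, μ)⁻¹)` changes along a `κ`-segment of `m` rungs by at most `m·p`, `p` a bound for the translation
discrepancies `dist1 (W(∂p(z′ + t))·W(∂p(z′))⁻¹)` of the gauged plaquettes met; walking the comb below `μ` (§4 `comb_walk`, induction on the level)
reduces `D(x, t)` to `D` at the point with the coordinates below the level reset, at cost `(level)·R·p` (also §4 `seg_plaquettes`: a segment of `m`
plaquettes costs `m·a`).  File 2∕2 turns this into `dist1 (W(x + s, μ)·W(x, μ)⁻¹) ≤ d·S·a + d²·R·p` (claims A∕B + telescoping over the coordinates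
of `s`), the (★) row once R3′ (w5 g14, the K-uniform curvature ½-Hölder modulus in the axial gauge) supplies `p`.  The word-level two-field ladder
comparison is ✓`UnitScaleTiltLadderHolonomyModulus` (R1); this is its pointwise form along the comb (no prefix bookkeeping of tree words).

HONEST SCOPE.  Lattice gauge bookkeeping and `dist1` algebra; nothing of (★)'s analytic input (R3′, the curvature Hölder modulus), GRAD, `hT`, `hGF`,
EX, `MinimiserStabilityRegPr` (19200) or the rung `YM3TorusSU2` is proved; no summit statement is proved; the Yang–Mills mass gap is NOT proved.
References: [Balaban1985Averaging] (8)–(9) pp. 18–19, pp. 24–25 (axial gauge, «V₀(x, x + e₁) = 1, |V₀(x, x + e₂) − 1| < |x₁ − y₁|α₀, …»),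
(44)–(45) p. 24, (46) p. 25; [Balaban1985RegularSpaces] (1.7)–(1.9) p. 77.
-/

set_option autoImplicit false

open Literature.MathematicalPhysics.QuantumFieldTheory.Balaban1983to89
open Literature.MathematicalPhysics.QuantumFieldTheory.Balaban1983to89.B7Prop1Explicit (Site e e_apply hol plaqWord gaugeAct axialFn
  disp_plaqWord hol_gaugeAct_closed)
open Literature.MathematicalPhysics.QuantumFieldTheory.Balaban1983to89.B7Prop1Local (hol_plaqWord_eq)
open Literature.MathematicalPhysics.QuantumFieldTheory.Balaban1983to89.B8Lemma1NonAbelian (lowPart lowPart_apply lowPart_add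
  lowPart_zsmul_e_of_le zsmul_e_apply axial_treeBond_eq_one)

namespace Summit.QuantumFields.YangMills.Theorems.AxialGaugeCombWalk

variable {d : ℕ} {G : Type*}

/-! ## §1 Lattice bookkeeping: the part of a vector below a coordinate, resets, segments -/

/-- `lowPart ν z = 0` says: the coordinates of `z` below `ν` vanish. [folklore] -/
theorem lowPart_eq_zero_iff (ν : Fin d) (z : Site d) : lowPart ν z = 0 ↔ ∀ κ : Fin d, κ < ν → z κ = 0 := by
  constructor
  · intro h κ hκ
    have := congrFun h κ
    simpa [lowPart_apply, hκ] using this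
  · intro h
    funext κ
    simp only [lowPart_apply, Pi.zero_apply]
    split_ifs with h1
    · exact h κ h1
    · rfl

/-- A unit vector `e_μ` has no part below `ν ≤ μ`. [folklore] -/
theorem lowPart_e_of_le {ν μ : Fin d} (h : ν ≤ μ) : lowPart ν (e μ : Site d) = 0 := by
  have := lowPart_zsmul_e_of_le h 1
  rwa [one_zsmul] at this

/-- The reset of the coordinates below `k` has no part below level `k`. [folklore] -/
theorem lowPart_reset (k : ℕ) (hkd : k < d) (x : Site d) :
    lowPart (⟨k, hkd⟩ : Fin d) (fun κ : Fin d => if κ.val < k then (0 : ℤ) else x κ) = 0 := by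
  rw [lowPart_eq_zero_iff]
  intro κ hκ
  rw [Fin.lt_def] at hκ
  simp [hκ]

/-- Resetting one more coordinate: `reset_{k+1} x = reset_k x − x_k e_k`. [folklore] -/
theorem reset_succ (k : ℕ) (hkd : k < d) (x : Site d) :
    (fun κ : Fin d => if κ.val < k + 1 then (0 : ℤ) else x κ) =
      (fun κ : Fin d => if κ.val < k then (0 : ℤ) else x κ) - x ⟨k, hkd⟩ • e (⟨k, hkd⟩ : Fin d) := by
  funext κ
  simp only [Pi.sub_apply, zsmul_e_apply]
  by_cases h1 : κ.val < k
  · have h2 : κ ≠ ⟨k, hkd⟩ := fun h => by subst h; simp at h1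
    simp [h1, show κ.val < k + 1 by omega, h2]
  · by_cases h2 : κ.val = k
    · have h3 : κ = ⟨k, hkd⟩ := Fin.ext h2
      subst h3
      simp
    · have h3 : κ ≠ ⟨k, hkd⟩ := fun h => h2 (by rw [h])
      simp [h1, show ¬ κ.val < k + 1 by omega, h3]

/-- The reset at level `0` is the identity. [folklore] -/
theorem reset_zero (x : Site d) : (fun κ : Fin d => if κ.val < 0 then (0 : ℤ) else x κ) = x := by
  funext κ; simp

/-- A reset of a point of the box `{|z_κ| ≤ R}` lies in the box. [folklore] -/
theorem abs_reset_le {R : ℕ} {x : Site d} (hx : ∀ κ, |x κ| ≤ (R : ℤ)) (k : ℕ) (κ : Fin d) :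
    |(fun κ' : Fin d => if κ'.val < k then (0 : ℤ) else x κ') κ| ≤ (R : ℤ) := by
  simp only
  split_ifs
  · simp
  · exact hx κ

/-- Points of an axis segment issued from a point vanishing below the axis still vanish below it. [folklore] -/
theorem lowPart_add_zsmul_e {ν : Fin d} {z : Site d} (hz : lowPart ν z = 0) (n : ℤ) : lowPart ν (z + n • e ν) = 0 := by
  rw [lowPart_add, hz, lowPart_zsmul_e_of_le le_rfl, add_zero]

/-! ## §2 The rung recursion in the complete axial gauge (any group) -/

section GroupLevel

variable [Group G]

/-- ★ **THE RUNG RECURSION**: in the complete axial gauge `W = V^{v₀}` based at `0`, for `κ < μ` and `z` vanishing below `κ` (so that the rails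
`W(z, κ)`, `W(z + e_μ, κ)` are tree bonds, ✓`axial_treeBond_eq_one`), `W(z + e_κ, μ) = W(∂p_{κμ}(z))·W(z, μ)`. [cite: Balaban1985Averaging, pp.24-25] -/
theorem axial_bond_step (V : Site d → Fin d → G) (z : Site d) {κ μ : Fin d} (hκμ : κ < μ) (hz : lowPart κ z = 0) :
    gaugeAct (axialFn V 0) V (z + e κ) μ =
      hol (gaugeAct (axialFn V 0) V) z (plaqWord κ μ) * gaugeAct (axialFn V 0) V z μ := by
  have h1 : gaugeAct (axialFn V 0) V z κ = 1 := axial_treeBond_eq_one V 0 z κ (by rwa [sub_zero])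
  have h2 : gaugeAct (axialFn V 0) V (z + e μ) κ = 1 :=
    axial_treeBond_eq_one V 0 (z + e μ) κ (by rw [sub_zero, lowPart_add, hz, lowPart_e_of_le hκμ.le, add_zero])
  rw [hol_plaqWord_eq, h1, h2, one_mul, inv_one, mul_one, inv_mul_cancel_right]

/-- Bonds at points vanishing below their direction are tree bonds: `W(z, μ) = 1` (✓`axial_treeBond_eq_one` at base `0`). [cite: Balaban1985Averaging, p.24] -/
theorem axial_bond_eq_one (V : Site d → Fin d → G) (z : Site d) (μ : Fin d) (hz : lowPart μ z = 0) :
    gaugeAct (axialFn V 0) V z μ = 1 :=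
  axial_treeBond_eq_one V 0 z μ (by rwa [sub_zero])

end GroupLevel

/-! ## §3 One rung, and a segment of rungs, read at `z` and at `z + t` -/

section Dist

variable [GaugeGroup G]

/-- Gauged plaquette variables are conjugates of the original ones: same `dist1`. [cite: Balaban1985Averaging, (9) p.19] -/
theorem dist1_hol_plaqWord_gaugeAct (u : Site d → G) (V : Site d → Fin d → G) (z : Site d) (κ μ : Fin d) :
    dist1 (hol (gaugeAct u V) z (plaqWord κ μ)) = dist1 (hol V z (plaqWord κ μ)) := by
  rw [hol_gaugeAct_closed u V z _ (disp_plaqWord κ μ), GaugeGroup.dist1_conj]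

/-- `dist1` ALGEBRA OF ONE RUNG: with `X′ = P′A′`, `X = PA`, `|d(X′, X) − d(A′, A)| ≤ d(P′, P)` where `d(g, h) = dist1 (g·h⁻¹)`. [cite: Balaban1985Averaging, (19) p.21] -/
theorem dist1_rung (P P' A A' : G) :
    dist1 (P' * A' * (P * A)⁻¹) ≤ dist1 (A' * A⁻¹) + dist1 (P' * P⁻¹) ∧
      dist1 (A' * A⁻¹) ≤ dist1 (P' * A' * (P * A)⁻¹) + dist1 (P' * P⁻¹) := by
  constructor
  · have e1 : P' * A' * (P * A)⁻¹ = P' * (A' * A⁻¹) * P'⁻¹ * (P' * P⁻¹) := by group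
    rw [e1]
    refine (GaugeGroup.dist1_mul_le _ _).trans ?_
    rw [GaugeGroup.dist1_conj]
  · have e1 : A' * A⁻¹ = P'⁻¹ * (P' * A' * (P * A)⁻¹) * P'⁻¹⁻¹ * (P⁻¹ * (P * P'⁻¹) * P⁻¹⁻¹) := by group
    have h3 : dist1 (P * P'⁻¹) = dist1 (P' * P⁻¹) := by
      rw [← GaugeGroup.dist1_inv (P * P'⁻¹), mul_inv_rev, inv_inv]
    rw [e1]
    refine (GaugeGroup.dist1_mul_le _ _).trans ?_
    rw [GaugeGroup.dist1_conj, GaugeGroup.dist1_conj, h3]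

/-- ★★ **A SEGMENT OF RUNGS READ AT `z` AND AT `z + t`**: for `κ < μ`, `z` and `t` vanishing below `κ`, and `m` rungs along `e_κ` whose gauged
plaquettes have translation discrepancy `dist1 (W(∂p(z + t + ie_κ))·W(∂p(z + ie_κ))⁻¹) ≤ p` (`i < m`), the discrepancy
`D(z′) = dist1 (W(z′ + t, μ)·W(z′, μ)⁻¹)` satisfies `|D(z + me_κ) − D(z)| ≤ m·p` (both one-sided forms). [cite: Balaban1985Averaging, (44)-(45) p.24, (46) p.25] -/
theorem seg_rungs (V : Site d → Fin d → G) {κ μ : Fin d} (hκμ : κ < μ) (z t : Site d) (hz : lowPart κ z = 0)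
    (ht : lowPart κ t = 0) {p : ℝ} :
    ∀ m : ℕ, (∀ i : ℕ, i < m →
      dist1 (hol (gaugeAct (axialFn V 0) V) (z + t + (i : ℤ) • e κ) (plaqWord κ μ) *
        (hol (gaugeAct (axialFn V 0) V) (z + (i : ℤ) • e κ) (plaqWord κ μ))⁻¹) ≤ p) →
      dist1 (gaugeAct (axialFn V 0) V (z + t + (m : ℤ) • e κ) μ * (gaugeAct (axialFn V 0) V (z + (m : ℤ) • e κ) μ)⁻¹) ≤
          dist1 (gaugeAct (axialFn V 0) V (z + t) μ * (gaugeAct (axialFn V 0) V z μ)⁻¹) + m * p ∧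
        dist1 (gaugeAct (axialFn V 0) V (z + t) μ * (gaugeAct (axialFn V 0) V z μ)⁻¹) ≤
          dist1 (gaugeAct (axialFn V 0) V (z + t + (m : ℤ) • e κ) μ * (gaugeAct (axialFn V 0) V (z + (m : ℤ) • e κ) μ)⁻¹) + m * p
  | 0, _ => by simp
  | m + 1, hmod => by
    obtain ⟨ih1, ih2⟩ := seg_rungs V hκμ z t hz ht m (fun i hi => hmod i (by omega))
    have hzm : lowPart κ (z + (m : ℤ) • e κ) = 0 := lowPart_add_zsmul_e hz m
    have hzt : lowPart κ (z + t) = 0 := by rw [lowPart_add, hz, ht, add_zero]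
    have hztm : lowPart κ (z + t + (m : ℤ) • e κ) = 0 := lowPart_add_zsmul_e hzt m
    have e1 : z + ((m + 1 : ℕ) : ℤ) • e κ = z + (m : ℤ) • e κ + e κ := by
      push_cast; rw [add_smul, one_smul]; abel
    have e2 : z + t + ((m + 1 : ℕ) : ℤ) • e κ = z + t + (m : ℤ) • e κ + e κ := by
      push_cast; rw [add_smul, one_smul]; abel
    rw [e1, e2, axial_bond_step V _ hκμ hzm, axial_bond_step V _ hκμ hztm]
    have hr := dist1_rung (hol (gaugeAct (axialFn V 0) V) (z + (m : ℤ) • e κ) (plaqWord κ μ))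
      (hol (gaugeAct (axialFn V 0) V) (z + t + (m : ℤ) • e κ) (plaqWord κ μ))
      (gaugeAct (axialFn V 0) V (z + (m : ℤ) • e κ) μ) (gaugeAct (axialFn V 0) V (z + t + (m : ℤ) • e κ) μ)
    have hpm := hmod m (by omega)
    push_cast
    constructor
    · linarith [hr.1]
    · linarith [hr.2]

/-! ## §4 Walking the comb below a level; a segment of plaquettes -/

/-- ★★ **A SEGMENT OF PLAQUETTES**: for `κ < μ` and `z` vanishing below `κ`, `dist1 (W(z + me_κ, μ)·W(z, μ)⁻¹) ≤ m·a` when the `m` gauged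
plaquettes `W(∂p_{κμ}(z + ie_κ))`, `i < m`, are within `a` of `1` (iterate the rung recursion; `dist1` of a product). [cite: Balaban1985Averaging, (44)-(45) p.24, (46) p.25] -/
theorem seg_plaquettes (V : Site d → Fin d → G) {κ μ : Fin d} (hκμ : κ < μ) (z : Site d) (hz : lowPart κ z = 0) {a : ℝ} :
    ∀ m : ℕ, (∀ i : ℕ, i < m → dist1 (hol (gaugeAct (axialFn V 0) V) (z + (i : ℤ) • e κ) (plaqWord κ μ)) ≤ a) →
      dist1 (gaugeAct (axialFn V 0) V (z + (m : ℤ) • e κ) μ * (gaugeAct (axialFn V 0) V z μ)⁻¹) ≤ m * a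
  | 0, _ => by simp [GaugeGroup.dist1_one]
  | m + 1, hplaq => by
    have ih := seg_plaquettes V hκμ z hz m (fun i hi => hplaq i (by omega))
    have hzm : lowPart κ (z + (m : ℤ) • e κ) = 0 := lowPart_add_zsmul_e hz m
    have e1 : z + ((m + 1 : ℕ) : ℤ) • e κ = z + (m : ℤ) • e κ + e κ := by
      push_cast; rw [add_smul, one_smul]; abel
    rw [e1, axial_bond_step V _ hκμ hzm, mul_assoc]
    refine (GaugeGroup.dist1_mul_le _ _).trans ?_
    have := hplaq m (by omega)
    push_cast
    linarith

/-- ★★ **WALKING THE COMB BELOW LEVEL `k ≤ μ`**: for a translation `t` vanishing below `k` (a coordinate restriction of `s`), the discrepancy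
`D(x, t) = dist1 (W(x + t, μ)·W(x, μ)⁻¹)` is at most the discrepancy at the point with the coordinates below `k` reset to `0`, plus `k·R·p`,
for `x` in the box `{|z_κ| ≤ R}` — `p` bounding the translation discrepancies `dist1 (W(∂p_{κμ}(z + t′))·W(∂p_{κμ}(z))⁻¹)` (`κ < μ`) over the box for
all coordinate restrictions `t′` of `s` (induction on `k`: one axis segment of `|x_k| ≤ R` rungs per level, §3 `seg_rungs`). [cite: Balaban1985Averaging, pp.24-25] -/
theorem comb_walk (V : Site d → Fin d → G) (μ : Fin d) {R : ℕ} {p : ℝ} (hp : 0 ≤ p) (s : Site d)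
    (hmod : ∀ z t : Site d, (∀ κ, |z κ| ≤ (R : ℤ)) → (∀ κ, t κ = s κ ∨ t κ = 0) →
      ∀ κ : Fin d, κ < μ → dist1 (hol (gaugeAct (axialFn V 0) V) (z + t) (plaqWord κ μ) *
        (hol (gaugeAct (axialFn V 0) V) z (plaqWord κ μ))⁻¹) ≤ p) :
    ∀ k : ℕ, k ≤ μ.val → ∀ x t : Site d, (∀ κ, |x κ| ≤ (R : ℤ)) → (∀ κ, t κ = s κ ∨ t κ = 0) →
      (∀ κ : Fin d, κ.val < k → t κ = 0) →
      dist1 (gaugeAct (axialFn V 0) V (x + t) μ * (gaugeAct (axialFn V 0) V x μ)⁻¹) ≤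
        dist1 (gaugeAct (axialFn V 0) V ((fun κ : Fin d => if κ.val < k then (0 : ℤ) else x κ) + t) μ *
            (gaugeAct (axialFn V 0) V (fun κ : Fin d => if κ.val < k then (0 : ℤ) else x κ) μ)⁻¹) + k * R * p
  | 0, _, x, t, _, _, _ => by
    rw [reset_zero]; simp
  | k + 1, hk, x, t, hx, hts, htk => by
    have hkd : k < d := by have := μ.isLt; omega
    have hνμ : (⟨k, hkd⟩ : Fin d) < μ := by rw [Fin.lt_def]; exact hk
    have ih := comb_walk V μ hp s hmod k (by omega) x t hx hts (fun κ hκ => htk κ (by omega))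
    rw [reset_succ k hkd x]
    -- the two reset points `x₁ = reset_k x`, `x₂ = x₁ − x_k e_k`, and `t` vanish below `k`
    have hx₁low : lowPart (⟨k, hkd⟩ : Fin d) (fun κ : Fin d => if κ.val < k then (0 : ℤ) else x κ) = 0 := lowPart_reset k hkd x
    have htlow : lowPart (⟨k, hkd⟩ : Fin d) t = 0 := by
      rw [lowPart_eq_zero_iff]; intro κ hκ; rw [Fin.lt_def] at hκ; exact htk κ (by simpa using Nat.lt_succ_of_lt hκ)
    have htk0 : t ⟨k, hkd⟩ = 0 := htk ⟨k, hkd⟩ (by simp)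
    have hxk : |x ⟨k, hkd⟩| ≤ (R : ℤ) := hx ⟨k, hkd⟩
    -- box membership of the segment points `x₁ + j e_k` with `j` between `−x_k` and `0` relative to `x₁`'s `k`-coordinate `x_k`
    have hbox : ∀ j : ℤ, |x ⟨k, hkd⟩ + j| ≤ (R : ℤ) → ∀ κ : Fin d,
        |((fun κ' : Fin d => if κ'.val < k then (0 : ℤ) else x κ') + j • e (⟨k, hkd⟩ : Fin d)) κ| ≤ (R : ℤ) := by
      intro j hj κ
      simp only [Pi.add_apply, zsmul_e_apply]
      by_cases h1 : κ = ⟨k, hkd⟩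
      · subst h1; simpa using hj
      · rw [if_neg h1, add_zero]; exact abs_reset_le hx k κ
    -- sign of `x_k`
    rcases Int.eq_nat_or_neg (x ⟨k, hkd⟩) with ⟨m, hm | hm⟩
    · -- `x_k = m ≥ 0`: `x₁ = x₂ + m e_k`, first form of `seg_rungs` from `x₂`
      have hmRz : (m : ℤ) ≤ R := by rw [← hm]; exact (le_abs_self _).trans hxk
      have hmR : (m : ℝ) ≤ R := by exact_mod_cast hmRz
      have hx₂low : lowPart (⟨k, hkd⟩ : Fin d)
          ((fun κ : Fin d => if κ.val < k then (0 : ℤ) else x κ) - x ⟨k, hkd⟩ • e (⟨k, hkd⟩ : Fin d)) = 0 := by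
        rw [sub_eq_add_neg, ← neg_zsmul]; exact lowPart_add_zsmul_e hx₁low _
      have hseg := (seg_rungs V hνμ _ t hx₂low htlow (p := p) m (fun i hi => by
        rw [show (fun κ : Fin d => if κ.val < k then (0 : ℤ) else x κ) - x ⟨k, hkd⟩ • e (⟨k, hkd⟩ : Fin d) + t + (i : ℤ) • e ⟨k, hkd⟩ =
          ((fun κ : Fin d => if κ.val < k then (0 : ℤ) else x κ) + (-(x ⟨k, hkd⟩) + i) • e (⟨k, hkd⟩ : Fin d)) + t by
            rw [add_smul, neg_zsmul]; abel,
          show (fun κ : Fin d => if κ.val < k then (0 : ℤ) else x κ) - x ⟨k, hkd⟩ • e (⟨k, hkd⟩ : Fin d) + (i : ℤ) • e ⟨k, hkd⟩ =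
          (fun κ : Fin d => if κ.val < k then (0 : ℤ) else x κ) + (-(x ⟨k, hkd⟩) + i) • e (⟨k, hkd⟩ : Fin d) by
            rw [add_smul, neg_zsmul]; abel]
        refine hmod _ t (hbox _ (by rw [hm, abs_le]; constructor <;> omega)) hts _ hνμ)).1
      have e3 : (fun κ : Fin d => if κ.val < k then (0 : ℤ) else x κ) - x ⟨k, hkd⟩ • e (⟨k, hkd⟩ : Fin d) + t + (m : ℤ) • e ⟨k, hkd⟩ =
          (fun κ : Fin d => if κ.val < k then (0 : ℤ) else x κ) + t := by rw [← hm]; abel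
      have e4 : (fun κ : Fin d => if κ.val < k then (0 : ℤ) else x κ) - x ⟨k, hkd⟩ • e (⟨k, hkd⟩ : Fin d) + (m : ℤ) • e ⟨k, hkd⟩ =
          (fun κ : Fin d => if κ.val < k then (0 : ℤ) else x κ) := by rw [← hm]; abel
      rw [e3, e4] at hseg
      have : (m : ℝ) * p ≤ R * p := mul_le_mul_of_nonneg_right hmR hp
      push_cast
      linarith
    · -- `x_k = −m ≤ 0`: `x₂ = x₁ + m e_k`, second form of `seg_rungs` from `x₁`
      have hmRz : (m : ℤ) ≤ R := by
        have h1 : |x ⟨k, hkd⟩| ≤ (R : ℤ) := hxk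
        rw [hm, abs_neg] at h1; exact (le_abs_self _).trans h1
      have hmR : (m : ℝ) ≤ R := by exact_mod_cast hmRz
      have hseg := (seg_rungs V hνμ _ t hx₁low htlow (p := p) m (fun i hi => by
        rw [show (fun κ : Fin d => if κ.val < k then (0 : ℤ) else x κ) + t + (i : ℤ) • e (⟨k, hkd⟩ : Fin d) =
          ((fun κ : Fin d => if κ.val < k then (0 : ℤ) else x κ) + (i : ℤ) • e (⟨k, hkd⟩ : Fin d)) + t by abel]
        refine hmod _ t (hbox _ (by rw [hm, abs_le]; constructor <;> omega)) hts _ hνμ)).2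
      have e3 : (fun κ : Fin d => if κ.val < k then (0 : ℤ) else x κ) - x ⟨k, hkd⟩ • e (⟨k, hkd⟩ : Fin d) =
          (fun κ : Fin d => if κ.val < k then (0 : ℤ) else x κ) + (m : ℤ) • e ⟨k, hkd⟩ := by rw [hm, neg_zsmul, sub_neg_eq_add]
      rw [e3, show (fun κ : Fin d => if κ.val < k then (0 : ℤ) else x κ) + (m : ℤ) • e (⟨k, hkd⟩ : Fin d) + t =
        (fun κ : Fin d => if κ.val < k then (0 : ℤ) else x κ) + t + (m : ℤ) • e (⟨k, hkd⟩ : Fin d) by abel]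
      have : (m : ℝ) * p ≤ R * p := mul_le_mul_of_nonneg_right hmR hp
      push_cast
      linarith [hseg]

end Dist

end Summit.QuantumFields.YangMills.Theorems.AxialGaugeCombWalk
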